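import Literature.Probability.RandomPlanarGeometry.TwoSidedPathCounting
import Literature.Probability.RandomPlanarGeometry.PlanarSRWMaximalTail
import Literature.Probability.RandomPlanarGeometry.PlanarSRWLocalLowerBound
import HarnessLib

/-!
# Non-intersecting pairs of planar walks: the upper bound `N(k)/16^k ≤ C k^{-1/2}`

Ninth proof file of the `PlaneNonIntersection` story and the conclusion of the `k^{-1/2}`
programme: the upper half of Lawler's elementary two-sided estimate
(*Intersections of Random Walks* (1991), (3.29) = (5.1), `f(n) ≤ c₂ n^{-1/2}` in `d = 2`) for the
quantity of the named fact `LSW2001_srw_nonIntersection_five_eighths` (`PlaneNonIntersection.lean`):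

  `nonIntersectingPairs k / 16^k ≤ C · k^{-1/2}` for all `k ≥ 1` (`nonIntersectingPairs_div_le_rpow`).

This improves the recurrence bound `O(1/log k)` of `PlaneNonIntersectionUpperBound.lean`; the
exponent `5/8` of the fact itself (Lawler–Schramm–Werner 2001) is NOT proved in the tree.

## The argument (Lawler 1991, §3.6, in a finite fixed-horizon form)

Write `q_n(y; A)` for the probability that the `n`-step walk from `y` avoids `A` at times `1..n`
(`escProb`), `λ = 1 - 1/n`, and
`F(n) = 16^{-n} Σ_{α, β ∈ StepSeq 2 n} q_n(0; verts α ∪ verts β)` — the probability that a walk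
from the origin avoids, up to time `n`, the traces of two other independent walks from the origin
(Lawler's `F(n)` of Theorem 3.5.1, the two-sided walk `W = (α reversed, β)`).

1. **Glue** (`sq_nonIntersectingPairs_div_le`): by Cauchy–Schwarz over the walk from `0` and the
   first-step decomposition of an escape (`card_escSet_stepVec_le`), `(N(k)/16^k)² ≤ 4 F(k)`.
2. **Truncation** (`trunc`): prefixes avoid less, so
   `(1 - λ^{n+1})² F(n) ≤ Φ := Σ_{t₂, t₃ ≤ n} (1-λ)² λ^{t₂+t₃} 4^{-(t₂+t₃)} Σ_{α, β} q_n(0; verts α ∪ verts β)`.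
3. **Multiplicity** (`TwoSidedMultiplicity.sum_escProb_le_sixteen_mul`, Lawler's Prop. 3.6.3):
   `Φ ≤ 16 Φ⁺`, `Φ⁺` the same sum restricted to right halves `β` not returning to the root.
4. **Bridge and identity** (`TwoSidedPathCounting.sum_sum_noRet_escProb_eq`,
   `TwoSidedEscapeIdentity.sum_escProb_verts_le`, Lawler's Thm. 3.6.1 / (3.24)):
   `Φ⁺ ≤ Σ_{ℓ ≤ 2n} (1-λ)² λ^ℓ 4^{-ℓ} Σ_{Γ ∈ StepSeq 2 ℓ} Σ_{x ∈ verts Γ} q_n(x; verts Γ)` and, for each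
   `Γ`, `Σ_{x ∈ verts Γ} q_n(x; verts Γ) ≤ 1/((1 - λ^{n+1}) g₀(Γ))` where `(ℓ+1) g₀(Γ)` bounds below the
   `Σ_j G^{L₁}_λ(x - Γ(j))`;
5. **Green function and tails** (`PlanarSRWLocalLowerBound`, Lawler's (3.27), here with the window
   constant `64`: `sum_pow_mul_prob_ge_of_le`; `PlanarSRWMaximalTail.sum_exp_maxNormSq_div_le`):
   `1/g₀(Γ) ≤ 4^{4000} e^{2400} e^{max_j |Γ(j)|²/(4n)}` and `4^{-ℓ} Σ_Γ e^{max|Γ|²/(4n)} ≤ 100` for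
   `ℓ ≤ 2n`, so `Φ⁺ ≤ 100 K₁ (1-λ)/(1-λ^{n+1})` (`K₁ = 4^{4000} e^{2400}`) and
   `F(n) ≤ 12800 · 100 K₁ / n` (`F_le`).

## References

* G. F. Lawler, *Intersections of Random Walks*, Birkhäuser 1991, Thm. 3.5.1, §3.6
  (Thm. 3.6.1, Props. 3.6.2–3.6.3, Lemma 3.2.4), (3.29) [Lawler1991].
* G. F. Lawler, O. Schramm, W. Werner, Acta Math. **187** (2001), §1
  [LawlerSchrammWerner2001PlaneExponents].
-/

noncomputable section

open Finset Real Literature.Probability.LatticeModels Literature.Probability.LatticeModels.SRW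
open scoped BigOperators

namespace Literature.Probability.RandomPlanarGeometry

namespace PlaneNonIntersection

/-! ### The Green-function constant -/

/-- The constant `4^{-4000}` of the Green-function lower bound, kept as a named real number so
that no tactic ever evaluates the power. [folklore] -/
def cB : ℝ := (1 / 4 : ℝ) ^ 4000

/-- `cB > 0`. [folklore] -/
theorem cB_pos : 0 < cB := pow_pos (by norm_num) _

/-- `cB⁻¹ · cB = 1`. [folklore] -/
theorem inv_cB_mul_cB : cB⁻¹ * cB = 1 := inv_mul_cancel₀ cB_pos.ne'

/-! ### The killed Green function at squared distance `s` (window constant `64`) -/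

/-- **Lawler's (3.27), finite form, squared-distance version**: for `0 ≤ λ ≤ 1`, `|z|² ≤ s` and a
horizon `L ≥ s/64 + 2400`, `Σ_{i ≤ L} λ^i p_i(z) ≥ 4^{-4000} λ^{s/64 + 2400}`. (As
`PlanarSRWLocalLowerBound.sum_pow_mul_prob_ge`, with the window `i = 2j + p`, `2q ≤ j < 3q`,
`q = ⌊s/512⌋` for `s ≥ 1200²` and one straight path otherwise.) [cite: Lawler1991, (3.27)] -/
theorem sum_pow_mul_prob_ge_of_le {lam : ℝ} (hl0 : 0 ≤ lam) (hl1 : lam ≤ 1) (z : Site 2) (s : ℕ)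
    (hs : (z 0) ^ 2 + (z 1) ^ 2 ≤ (s : ℤ)) (L : ℕ) (hL : s / 64 + 2400 ≤ L) :
    cB * lam ^ (s / 64 + 2400) ≤ ∑ i ∈ Finset.range (L + 1), lam ^ i * prob 2 i z := by
  show (1 / 4 : ℝ) ^ 4000 * lam ^ (s / 64 + 2400) ≤ _
  set r : ℕ := Nat.sqrt s with hr
  have hrs : r * r ≤ s := Nat.sqrt_le s
  have hsr : s < (r + 1) * (r + 1) := Nat.lt_succ_sqrt s
  have key : ∀ w : ℤ, w ^ 2 ≤ s → |w| ≤ r := by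
    intro w hw
    have hlt : w ^ 2 < ((r : ℤ) + 1) ^ 2 := by
      have : ((s : ℕ) : ℤ) < (((r + 1) * (r + 1) : ℕ) : ℤ) := by exact_mod_cast hsr
      push_cast at this
      nlinarith
    have := abs_lt_of_sq_lt_sq hlt (by positivity)
    omega
  have hz0 : |z 0| ≤ r := key (z 0) (by nlinarith [sq_nonneg (z 1)])
  have hz1 : |z 1| ≤ r := key (z 1) (by nlinarith [sq_nonneg (z 0)])
  have hnonneg : ∀ i ∈ Finset.range (L + 1), 0 ≤ lam ^ i * prob 2 i z :=
    fun i _ => mul_nonneg (pow_nonneg hl0 i) (prob_nonneg i z)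
  set T : ℕ := s / 64 + 2400 with hT
  by_cases hsmall : s < 1440000
  · -- one straight path of length `|z₀| + |z₁| ≤ 2r ≤ 2398`
    have hr1200 : r < 1200 := by
      by_contra h
      have h' : 1200 ≤ r := not_lt.1 h
      have : 1200 * 1200 ≤ r * r := Nat.mul_le_mul h' h'
      omega
    set i₀ : ℕ := Int.natAbs (z 0) + Int.natAbs (z 1) with hi₀
    have hi₀r : i₀ ≤ 2 * r := by
      have h0 : (Int.natAbs (z 0) : ℤ) ≤ r := by rw [Int.natCast_natAbs]; exact hz0
      have h1 : (Int.natAbs (z 1) : ℤ) ≤ r := by rw [Int.natCast_natAbs]; exact hz1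
      omega
    have hi₀T : i₀ ≤ T := by omega
    have hi₀L : i₀ ∈ Finset.range (L + 1) := Finset.mem_range.2 (by omega)
    have hterm : (1 / 4 : ℝ) ^ 4000 * lam ^ T ≤ lam ^ i₀ * prob 2 i₀ z := by
      have hc : (1 : ℝ) ≤ count 2 i₀ z := by exact_mod_cast one_le_count_natAbs z
      have hp : (1 / 4 : ℝ) ^ i₀ ≤ prob 2 i₀ z := by
        rw [prob_two_eq, le_div_iff₀ (by positivity), one_div_pow, div_mul_cancel₀ _ (by positivity)]
        exact hc
      have h1 : lam ^ T ≤ lam ^ i₀ := pow_le_pow_of_le_one hl0 hl1 hi₀T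
      have h2 : (1 / 4 : ℝ) ^ 4000 ≤ (1 / 4 : ℝ) ^ i₀ :=
        pow_le_pow_of_le_one (by norm_num) (by norm_num) (by omega)
      calc (1 / 4 : ℝ) ^ 4000 * lam ^ T ≤ (1 / 4 : ℝ) ^ i₀ * lam ^ i₀ :=
            mul_le_mul h2 h1 (pow_nonneg hl0 _) (by positivity)
        _ = lam ^ i₀ * (1 / 4 : ℝ) ^ i₀ := mul_comm _ _
        _ ≤ lam ^ i₀ * prob 2 i₀ z := mul_le_mul_of_nonneg_left hp (pow_nonneg hl0 _)
    exact hterm.trans (Finset.single_le_sum hnonneg hi₀L)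
  · -- the window
    have hsbig : 1440000 ≤ s := not_lt.1 hsmall
    have hr1200 : 1200 ≤ r := by
      by_contra h
      have h' : r + 1 ≤ 1200 := by omega
      have : (r + 1) * (r + 1) ≤ 1200 * 1200 := Nat.mul_le_mul h' h'
      omega
    have hrs' : 1200 * r ≤ s := le_trans (Nat.mul_le_mul_right r hr1200) hrs
    set q : ℕ := s / 512 with hq
    have hq1 : 1 ≤ q := by omega
    set u : ℤ := z 0 + z 1 with hu
    set p : ℕ := (u % 2).toNat with hp
    have hpu : (p : ℤ) = u % 2 := by rw [hp, Int.toNat_of_nonneg (Int.emod_nonneg _ two_ne_zero)]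
    have hp1 : p ≤ 1 := by
      have := Int.emod_two_eq_zero_or_one u
      omega
    set W : Finset ℕ := (Finset.Ico (2 * q) (3 * q)).image fun j => 2 * j + p with hW
    have hWcard : #W = q := by
      rw [hW, Finset.card_image_of_injective _ fun a b h => by simpa using h, Nat.card_Ico]
      omega
    have hmemW : ∀ i ∈ W, ∃ j, 2 * q ≤ j ∧ j < 3 * q ∧ i = 2 * j + p := by
      intro i hi
      rw [hW, Finset.mem_image] at hi
      obtain ⟨j, hj, rfl⟩ := hi
      exact ⟨j, (Finset.mem_Ico.1 hj).1, (Finset.mem_Ico.1 hj).2, rfl⟩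
    have hWsub : W ⊆ Finset.range (L + 1) := by
      intro i hi
      obtain ⟨j, hj1, hj2, rfl⟩ := hmemW i hi
      rw [Finset.mem_range]
      omega
    have hterm : ∀ i ∈ W, lam ^ T * (Real.exp (-517) / (12 * q)) ≤ lam ^ i * prob 2 i z := by
      intro i hi
      obtain ⟨j, hj1, hj2, hij⟩ := hmemW i hi
      have hi4q : 4 * q ≤ i := by omega
      have hi6q : i + 1 ≤ 6 * q := by omega
      have hiT : i ≤ T := by omega
      have hi1 : 1 ≤ i := by omega
      have hpar : Even ((i : ℤ) + (z 0 + z 1)) := by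
        refine ⟨(j : ℤ) + p + u / 2, ?_⟩
        have hiz : (i : ℤ) = 2 * j + p := by exact_mod_cast hij
        omega
      have h8r : 8 * (r : ℤ) + 6 ≤ (i : ℤ) := by
        have h1 : 8 * r + 6 ≤ 4 * q := by omega
        have h2 : 8 * r + 6 ≤ i := by omega
        exact_mod_cast h2
      have hu4 : 4 * |z 0 + z 1| + 6 ≤ (i : ℤ) := by
        have := abs_add_le (z 0) (z 1)
        linarith
      have hv4 : 4 * |z 0 - z 1| + 6 ≤ (i : ℤ) := by
        have := abs_sub (z 0) (z 1)
        linarith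
      have hcount := count_two_ge hi1 z hpar hu4 hv4
      have hiR : (0 : ℝ) < (i : ℝ) := by exact_mod_cast hi1
      have hexp : Real.exp (-513) ≤ Real.exp (-(4 * ((z 0 : ℝ) ^ 2 + (z 1 : ℝ) ^ 2) / i)) := by
        refine Real.exp_le_exp.2 ?_
        rw [neg_le_neg_iff, div_le_iff₀ hiR]
        have h1 : 4 * s ≤ 513 * i := by omega
        have h2 : 4 * (s : ℝ) ≤ 513 * (i : ℝ) := by exact_mod_cast h1
        have h3 := (Int.cast_le (R := ℝ)).2 hs
        push_cast at h3
        linarith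
      have hprob : Real.exp (-517) / (12 * q) ≤ prob 2 i z := by
        rw [prob_two_eq, le_div_iff₀ (by positivity)]
        have h6 : 2 * ((i : ℝ) + 1) ≤ 12 * q := by
          have : ((2 * (i + 1) : ℕ) : ℝ) ≤ ((12 * q : ℕ) : ℝ) := by exact_mod_cast (by omega)
          push_cast at this
          linarith
        have hq0 : (0 : ℝ) < 12 * q := by positivity
        calc Real.exp (-517) / (12 * q) * 4 ^ i
            ≤ Real.exp (-517) / (2 * ((i : ℝ) + 1)) * 4 ^ i := by gcongr
          _ = 4 ^ i * Real.exp (-4) * Real.exp (-513) / (2 * ((i : ℝ) + 1)) := by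
              rw [show (-517 : ℝ) = -4 + -513 by norm_num, Real.exp_add]
              ring
          _ ≤ 4 ^ i * Real.exp (-4) *
                Real.exp (-(4 * ((z 0 : ℝ) ^ 2 + (z 1 : ℝ) ^ 2) / i)) / (2 * ((i : ℝ) + 1)) := by
              gcongr
          _ ≤ count 2 i z := hcount
      have hlam : lam ^ T ≤ lam ^ i := pow_le_pow_of_le_one hl0 hl1 hiT
      exact mul_le_mul hlam hprob (by positivity) (pow_nonneg hl0 _)
    have hconst : (1 / 4 : ℝ) ^ 4000 ≤ Real.exp (-517) / 12 := by
      have h1 : (1 / 4 : ℝ) ^ 517 ≤ Real.exp (-517) := by exact_mod_cast quarter_pow_le_exp_neg 517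
      have h2 : (1 / 4 : ℝ) ^ 3483 ≤ 1 / 12 := by
        calc (1 / 4 : ℝ) ^ 3483 ≤ (1 / 4 : ℝ) ^ 2 :=
              pow_le_pow_of_le_one (by norm_num) (by norm_num) (by norm_num)
          _ ≤ 1 / 12 := by norm_num
      calc (1 / 4 : ℝ) ^ 4000 = (1 / 4 : ℝ) ^ 517 * (1 / 4 : ℝ) ^ 3483 := by rw [← pow_add]
        _ ≤ Real.exp (-517) * (1 / 12) := mul_le_mul h1 h2 (by positivity) (Real.exp_pos _).le
        _ = Real.exp (-517) / 12 := by ring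
    have hq0 : (0 : ℝ) < q := by exact_mod_cast hq1
    calc (1 / 4 : ℝ) ^ 4000 * lam ^ T ≤ Real.exp (-517) / 12 * lam ^ T :=
          mul_le_mul_of_nonneg_right hconst (pow_nonneg hl0 _)
      _ = ∑ _i ∈ W, lam ^ T * (Real.exp (-517) / (12 * q)) := by
          rw [Finset.sum_const, hWcard, nsmul_eq_mul]
          field_simp
      _ ≤ ∑ i ∈ W, lam ^ i * prob 2 i z := Finset.sum_le_sum hterm
      _ ≤ ∑ i ∈ Finset.range (L + 1), lam ^ i * prob 2 i z :=
          Finset.sum_le_sum_of_subset_of_nonneg hWsub fun i hi _ => hnonneg i hi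

/-! ### The Green-function hypothesis for a path and the escape sum of a path -/

/-- `|a - b|² ≤ 2|a|² + 2|b|²` for lattice points. [folklore] -/
theorem normSq_sub_le (a b : Site 2) :
    (a 0 - b 0) ^ 2 + (a 1 - b 1) ^ 2 ≤ 2 * ((a 0) ^ 2 + (a 1) ^ 2) + 2 * ((b 0) ^ 2 + (b 1) ^ 2) := by
  nlinarith [sq_nonneg (a 0 + b 0), sq_nonneg (a 1 + b 1)]

/-- **The Green-function hypothesis** of `sum_escProb_verts_le` for a path: with
`s = 4 max_j |Γ(j)|²`, `L₁ ≥ s/64 + 2400`, and `g₀ = 4^{-4000} λ^{s/64 + 2400}`, every vertex `x` of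
`Γ` satisfies `(ℓ+1) g₀ ≤ Σ_{j ≤ ℓ} G^{L₁}_λ(x - Γ(j))` (all differences of vertices have squared
norm `≤ s`). [folklore] -/
theorem Gtr_hypothesis {lam : ℝ} (hl0 : 0 ≤ lam) (hl1 : lam ≤ 1) {ℓ : ℕ} (Γ : StepSeq 2 ℓ)
    (L₁ : ℕ) (hL : 4 * maxNormSq Γ / 64 + 2400 ≤ L₁) :
    ∀ x ∈ verts Γ, ((ℓ : ℝ) + 1) * (cB * lam ^ (4 * maxNormSq Γ / 64 + 2400)) ≤
      ∑ j ∈ Finset.range (ℓ + 1), Gtr lam L₁ (x - pos Γ j) := by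
  intro x hx
  rw [mem_verts] at hx
  obtain ⟨i, hi, rfl⟩ := hx
  have hterm : ∀ j ∈ Finset.range (ℓ + 1), cB * lam ^ (4 * maxNormSq Γ / 64 + 2400) ≤
      Gtr lam L₁ (pos Γ i - pos Γ j) := by
    intro j hj
    have hj' : j ≤ ℓ := Nat.le_of_lt_succ (Finset.mem_range.1 hj)
    refine sum_pow_mul_prob_ge_of_le hl0 hl1 (pos Γ i - pos Γ j) (4 * maxNormSq Γ) ?_ L₁ hL
    have h1 := normSq_le_maxNormSq Γ hi
    have h2 := normSq_le_maxNormSq Γ hj'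
    have h3 := normSq_sub_le (pos Γ i) (pos Γ j)
    simp only [Pi.sub_apply]
    push_cast
    linarith
  calc ((ℓ : ℝ) + 1) * (cB * lam ^ (4 * maxNormSq Γ / 64 + 2400))
      = ∑ _j ∈ Finset.range (ℓ + 1), cB * lam ^ (4 * maxNormSq Γ / 64 + 2400) := by
        rw [Finset.sum_const, Finset.card_range, nsmul_eq_mul]
        push_cast
        ring
    _ ≤ _ := Finset.sum_le_sum hterm

/-- `(1 - 1/n)^{-a} ≤ e^{2a/n}` for `n ≥ 2` (from `e^{-2x} ≤ 1 - x` on `[0, 1/2]`). [folklore] -/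
theorem inv_pow_le_exp {n : ℕ} (hn : 2 ≤ n) (a : ℕ) :
    ((1 - 1 / (n : ℝ)) ^ a)⁻¹ ≤ Real.exp (2 * a / n) := by
  have hn' : (0 : ℝ) < n := by positivity
  have hx0 : (0 : ℝ) ≤ 1 / n := by positivity
  have hx : 1 / (n : ℝ) ≤ 1 / 2 := by
    rw [div_le_div_iff₀ hn' (by norm_num)]
    have : (2 : ℝ) ≤ n := by exact_mod_cast hn
    linarith
  have h1 : Real.exp (-(2 * (1 / (n : ℝ)))) ≤ 1 - 1 / n := exp_neg_two_mul_le_one_sub hx0 hx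
  have h2 : Real.exp (-(2 * (1 / (n : ℝ)))) ^ a ≤ (1 - 1 / (n : ℝ)) ^ a :=
    pow_le_pow_left₀ (Real.exp_pos _).le h1 a
  have h3 : Real.exp (-(2 * (1 / (n : ℝ)))) ^ a = (Real.exp (2 * a / n))⁻¹ := by
    rw [← Real.exp_nat_mul, ← Real.exp_neg]
    congr 1
    field_simp
  rw [h3] at h2
  calc ((1 - 1 / (n : ℝ)) ^ a)⁻¹ ≤ ((Real.exp (2 * a / n))⁻¹)⁻¹ :=
        inv_anti₀ (inv_pos.2 (Real.exp_pos _)) h2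
    _ = Real.exp (2 * a / n) := inv_inv _

/-- **The escape sum of a path** (Lawler's (3.24) with (3.27) and the tail): for `n ≥ 2`,
`λ = 1 - 1/n`, `ℓ ≤ 2n` and every `Γ ∈ StepSeq 2 ℓ`,
`Σ_{x ∈ verts Γ} q_n(x; verts Γ) ≤ 4^{4000} e^{2400} e^{max_j |Γ(j)|²/(4n)} / (1 - λ^{n+1})`.
[cite: Lawler1991, (3.24)–(3.27)] -/
theorem sum_escProb_verts_le_exp {n : ℕ} (hn : 2 ≤ n) {ℓ : ℕ} (hℓ : ℓ ≤ 2 * n) (Γ : StepSeq 2 ℓ) :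
    ∑ x ∈ verts Γ, escProb n x (verts Γ) ≤
      cB⁻¹ * Real.exp 2400 * Real.exp ((maxNormSq Γ : ℝ) / (4 * n)) /
        (1 - (1 - 1 / (n : ℝ)) ^ (n + 1)) := by
  obtain ⟨lam, hlam⟩ : ∃ lam : ℝ, lam = 1 - 1 / (n : ℝ) := ⟨_, rfl⟩
  rw [← hlam]
  have hn' : (0 : ℝ) < n := by positivity
  have hn2 : (2 : ℝ) ≤ n := by exact_mod_cast hn
  have hlpos : 0 < lam := by
    rw [hlam, sub_pos, div_lt_one hn']
    linarith
  have hl0 : 0 ≤ lam := hlpos.le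
  have hl1 : lam < 1 := by
    rw [hlam]
    have : (0 : ℝ) < 1 / n := by positivity
    linarith
  obtain ⟨L₁, hL₁⟩ : ∃ L₁ : ℕ, L₁ = n ^ 2 + 2400 := ⟨_, rfl⟩
  have hM : maxNormSq Γ ≤ 2 * ℓ ^ 2 := maxNormSq_le Γ
  obtain ⟨b, hb⟩ : ∃ b : ℕ, b = 4 * maxNormSq Γ / 64 + 2400 := ⟨_, rfl⟩
  have hML : b ≤ L₁ := by
    have h1 : 4 * maxNormSq Γ ≤ 32 * n ^ 2 := by
      calc 4 * maxNormSq Γ ≤ 4 * (2 * ℓ ^ 2) := Nat.mul_le_mul_left 4 hM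
        _ = 8 * ℓ ^ 2 := by ring
        _ ≤ 8 * (2 * n) ^ 2 := Nat.mul_le_mul_left 8 (Nat.pow_le_pow_left hℓ 2)
        _ = 32 * n ^ 2 := by ring
    have h2 : 4 * maxNormSq Γ / 64 ≤ n ^ 2 := by omega
    omega
  have hnL : n ≤ L₁ := by
    rw [hL₁]
    exact Nat.le_add_right_of_le (Nat.le_self_pow two_ne_zero n)
  set g₀ : ℝ := cB * lam ^ b with hg₀
  have hg₀pos : 0 < g₀ := by rw [hg₀]; exact mul_pos cB_pos (pow_pos hlpos b)
  have hG := Gtr_hypothesis hl0 hl1.le Γ L₁ (by rw [← hb]; exact hML)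
  rw [← hb] at hG
  have hmain := sum_escProb_verts_le hl0 hl1 hnL Γ hg₀pos hG
  -- `1/g₀ ≤ 4^{4000} e^{2400} e^{M²/(4n)}`
  have hexp : Real.exp (2 * (b : ℝ) / n) ≤ Real.exp 2400 * Real.exp ((maxNormSq Γ : ℝ) / (4 * n)) := by
    rw [← Real.exp_add]
    refine Real.exp_le_exp.2 ?_
    have hdiv : (((4 * maxNormSq Γ / 64 : ℕ) : ℝ)) * 16 ≤ (maxNormSq Γ : ℝ) := by
      have : (4 * maxNormSq Γ / 64) * 16 ≤ maxNormSq Γ := by omega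
      exact_mod_cast this
    rw [div_le_iff₀ hn', hb]
    push_cast
    have hM0 : (0 : ℝ) ≤ maxNormSq Γ := Nat.cast_nonneg _
    have hd0 : (0 : ℝ) ≤ ((4 * maxNormSq Γ / 64 : ℕ) : ℝ) := Nat.cast_nonneg _
    have h16 : (maxNormSq Γ : ℝ) / (4 * n) * n = (maxNormSq Γ : ℝ) / 4 := by
      field_simp
    rw [add_mul, h16]
    linarith [hdiv, hn2, hM0, hd0]
  have hinv : 1 / g₀ ≤ cB⁻¹ * Real.exp 2400 * Real.exp ((maxNormSq Γ : ℝ) / (4 * n)) := by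
    have hbd := inv_pow_le_exp hn b
    rw [← hlam] at hbd
    have hlb : 0 < lam ^ b := pow_pos hlpos b
    have h1 : 1 ≤ lam ^ b * Real.exp (2 * (b : ℝ) / n) := by
      calc (1 : ℝ) = lam ^ b * (lam ^ b)⁻¹ := (mul_inv_cancel₀ hlb.ne').symm
        _ ≤ lam ^ b * Real.exp (2 * (b : ℝ) / n) := mul_le_mul_of_nonneg_left hbd hlb.le
    rw [div_le_iff₀ hg₀pos, hg₀]
    calc (1 : ℝ) ≤ lam ^ b * Real.exp (2 * (b : ℝ) / n) := h1
      _ ≤ lam ^ b * (Real.exp 2400 * Real.exp ((maxNormSq Γ : ℝ) / (4 * n))) :=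
          mul_le_mul_of_nonneg_left hexp hlb.le
      _ = lam ^ b * (Real.exp 2400 * Real.exp ((maxNormSq Γ : ℝ) / (4 * n))) * (cB⁻¹ * cB) := by
          rw [inv_cB_mul_cB, mul_one]
      _ = cB⁻¹ * Real.exp 2400 * Real.exp ((maxNormSq Γ : ℝ) / (4 * n)) * (cB * lam ^ b) := by ring
  have hc : 0 < 1 - lam ^ (n + 1) := by
    have : lam ^ (n + 1) < 1 := pow_lt_one₀ hl0 hl1 (Nat.succ_ne_zero n)
    linarith
  calc ∑ x ∈ verts Γ, escProb n x (verts Γ) ≤ 1 / ((1 - lam ^ (n + 1)) * g₀) := hmain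
    _ = 1 / g₀ / (1 - lam ^ (n + 1)) := by
        rw [div_div, mul_comm]
    _ ≤ cB⁻¹ * Real.exp 2400 * Real.exp ((maxNormSq Γ : ℝ) / (4 * n)) / (1 - lam ^ (n + 1)) :=
        div_le_div_of_nonneg_right hinv hc.le

/-! ### Regrouping `(t₂, t₃) ↦ (ℓ = t₂ + t₃, j = t₂)` -/

/-- `Σ_{a ≤ N} Σ_{b ≤ N} f(a+b, a) ≤ Σ_{ℓ ≤ 2N} Σ_{j ≤ ℓ} f(ℓ, j)` for nonnegative `f`. [folklore] -/
theorem sum_sum_le_sum_sigma {f : ℕ → ℕ → ℝ} (hf : ∀ a b, 0 ≤ f a b) (N : ℕ) :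
    ∑ a ∈ Finset.range (N + 1), ∑ b ∈ Finset.range (N + 1), f (a + b) a ≤
      ∑ ℓ ∈ Finset.range (2 * N + 1), ∑ j ∈ Finset.range (ℓ + 1), f ℓ j := by
  classical
  set P : Finset (ℕ × ℕ) := Finset.range (N + 1) ×ˢ Finset.range (N + 1) with hP
  set Q : Finset (Σ _ : ℕ, ℕ) := (Finset.range (2 * N + 1)).sigma fun ℓ => Finset.range (ℓ + 1)
    with hQ
  set φ : ℕ × ℕ → (Σ _ : ℕ, ℕ) := fun p => ⟨p.1 + p.2, p.1⟩ with hφ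
  have hinj : Set.InjOn φ P := by
    rintro ⟨a, b⟩ - ⟨a', b'⟩ - h
    simp only [hφ, Sigma.mk.injEq, heq_eq_eq] at h
    obtain ⟨h1, h2⟩ := h
    subst h2
    simp only [Prod.mk.injEq, true_and]
    omega
  have hsub : P.image φ ⊆ Q := by
    intro q hq
    rw [Finset.mem_image] at hq
    obtain ⟨⟨a, b⟩, hab, rfl⟩ := hq
    simp only [hP, Finset.mem_product, Finset.mem_range] at hab
    simp only [hQ, hφ, Finset.mem_sigma, Finset.mem_range]
    omega
  calc ∑ a ∈ Finset.range (N + 1), ∑ b ∈ Finset.range (N + 1), f (a + b) a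
      = ∑ p ∈ P, f (φ p).1 (φ p).2 := by rw [hP, Finset.sum_product]
    _ = ∑ q ∈ P.image φ, f q.1 q.2 := by rw [Finset.sum_image hinj]
    _ ≤ ∑ q ∈ Q, f q.1 q.2 := Finset.sum_le_sum_of_subset_of_nonneg hsub fun q _ _ => hf _ _
    _ = _ := by rw [hQ, Finset.sum_sigma]

/-! ### The bound on `Φ⁺` -/

/-- The path sum `Σ_{Γ ∈ StepSeq 2 ℓ} Σ_{x ∈ verts Γ} q_n(x; verts Γ) ≤ 100 K 4^ℓ/(1 - λ^{n+1})`
for `ℓ ≤ 2n`, `K = cB⁻¹ e^{2400}`. [folklore] -/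
theorem sum_sum_escProb_verts_le {n : ℕ} (hn : 2 ≤ n) {lam : ℝ} (hlam : lam = 1 - 1 / (n : ℝ))
    {ℓ : ℕ} (hℓ : ℓ ≤ 2 * n) :
    ∑ Γ : StepSeq 2 ℓ, ∑ x ∈ verts Γ, escProb n x (verts Γ) ≤
      100 * (cB⁻¹ * Real.exp 2400) * 4 ^ ℓ / (1 - lam ^ (n + 1)) := by
  have hn' : (0 : ℝ) < n := by positivity
  have hn1 : 1 ≤ n := by omega
  have hl0 : 0 ≤ lam := by
    rw [hlam, sub_nonneg, div_le_one hn']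
    have : (2 : ℝ) ≤ n := by exact_mod_cast hn
    linarith
  have hl1 : lam < 1 := by
    rw [hlam]
    have : (0 : ℝ) < 1 / n := by positivity
    linarith
  have hc : 0 < 1 - lam ^ (n + 1) := by
    have : lam ^ (n + 1) < 1 := pow_lt_one₀ hl0 hl1 (Nat.succ_ne_zero n)
    linarith
  have hK : 0 ≤ cB⁻¹ * Real.exp 2400 := mul_nonneg (inv_nonneg.2 cB_pos.le) (Real.exp_pos _).le
  -- per path
  have hpath : ∀ Γ : StepSeq 2 ℓ, ∑ x ∈ verts Γ, escProb n x (verts Γ) ≤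
      cB⁻¹ * Real.exp 2400 * Real.exp ((maxNormSq Γ : ℝ) / (4 * n)) / (1 - lam ^ (n + 1)) := by
    intro Γ
    have h := sum_escProb_verts_le_exp hn hℓ Γ
    rw [← hlam] at h
    exact h
  -- the exponential moment
  have hmom : ∑ Γ : StepSeq 2 ℓ, Real.exp ((maxNormSq Γ : ℝ) / (4 * n)) ≤ 100 * 4 ^ ℓ := by
    rcases Nat.eq_zero_or_pos ℓ with rfl | hℓ1
    · have h1 : ∀ Γ : StepSeq 2 0, Real.exp ((maxNormSq Γ : ℝ) / (4 * n)) = 1 := by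
        intro Γ
        have : maxNormSq Γ = 0 := by have := maxNormSq_le Γ; omega
        rw [this, Nat.cast_zero, zero_div, Real.exp_zero]
      rw [Finset.sum_congr rfl fun Γ _ => h1 Γ, Finset.sum_const, Finset.card_univ, card_stepSeq]
      norm_num
    · exact sum_exp_maxNormSq_div_le hn1 hℓ1 hℓ
  calc ∑ Γ : StepSeq 2 ℓ, ∑ x ∈ verts Γ, escProb n x (verts Γ)
      ≤ ∑ Γ : StepSeq 2 ℓ, cB⁻¹ * Real.exp 2400 * Real.exp ((maxNormSq Γ : ℝ) / (4 * n)) /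
          (1 - lam ^ (n + 1)) := Finset.sum_le_sum fun Γ _ => hpath Γ
    _ = cB⁻¹ * Real.exp 2400 / (1 - lam ^ (n + 1)) *
          ∑ Γ : StepSeq 2 ℓ, Real.exp ((maxNormSq Γ : ℝ) / (4 * n)) := by
        rw [Finset.mul_sum]
        refine Finset.sum_congr rfl fun Γ _ => ?_
        field_simp
    _ ≤ cB⁻¹ * Real.exp 2400 / (1 - lam ^ (n + 1)) * (100 * 4 ^ ℓ) :=
        mul_le_mul_of_nonneg_left hmom (div_nonneg hK hc.le)
    _ = 100 * (cB⁻¹ * Real.exp 2400) * 4 ^ ℓ / (1 - lam ^ (n + 1)) := by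
        field_simp

/-- `Σ_{ℓ ≤ 2n} λ^ℓ ≤ 1/(1 - λ)` for `0 ≤ λ < 1`. [folklore] -/
theorem geom_le {lam : ℝ} (hl0 : 0 ≤ lam) (hl1 : lam < 1) (m : ℕ) :
    ∑ ℓ ∈ Finset.range m, lam ^ ℓ ≤ 1 / (1 - lam) := by
  have h := geom_sum_mul_neg lam m
  rw [le_div_iff₀ (by linarith), h]
  linarith [pow_nonneg hl0 m]

/-- **The bound on `Φ⁺`** (bridge, last visits, the escape sum of each path, the exponential
moment, geometric weights):
`Σ_{t₂,t₃ ≤ n} (1-λ)²λ^{t₂+t₃}/4^{t₂+t₃} Σ_α Σ_{β ∈ noRet t₃} q_n(0; verts α ∪ verts β) ≤ 100 K (1-λ)/(1-λ^{n+1})`.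
[cite: Lawler1991, §3.6] -/
theorem phiPlus_le {n : ℕ} (hn : 2 ≤ n) {lam : ℝ} (hlam : lam = 1 - 1 / (n : ℝ)) :
    ∑ t₂ ∈ Finset.range (n + 1), ∑ t₃ ∈ Finset.range (n + 1),
        (1 - lam) ^ 2 * lam ^ (t₂ + t₃) / 4 ^ (t₂ + t₃) *
          ∑ α : StepSeq 2 t₂, ∑ β ∈ noRet t₃, escProb n 0 (verts α ∪ verts β) ≤
      100 * (cB⁻¹ * Real.exp 2400) * (1 - lam) / (1 - lam ^ (n + 1)) := by
  classical
  have hn' : (0 : ℝ) < n := by positivity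
  have hl0 : 0 ≤ lam := by
    rw [hlam, sub_nonneg, div_le_one hn']
    have : (2 : ℝ) ≤ n := by exact_mod_cast hn
    linarith
  have hl1 : lam < 1 := by
    rw [hlam]
    have : (0 : ℝ) < 1 / n := by positivity
    linarith
  have hc : 0 < 1 - lam ^ (n + 1) := by
    have : lam ^ (n + 1) < 1 := pow_lt_one₀ hl0 hl1 (Nat.succ_ne_zero n)
    linarith
  have hK : 0 ≤ cB⁻¹ * Real.exp 2400 := mul_nonneg (inv_nonneg.2 cB_pos.le) (Real.exp_pos _).le
  set w : ℕ → ℝ := fun ℓ => (1 - lam) ^ 2 * lam ^ ℓ / 4 ^ ℓ with hw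
  have hw0 : ∀ ℓ, 0 ≤ w ℓ := fun ℓ => by rw [hw]; positivity
  -- the rooted path sums
  set Bf : ℕ → ℕ → ℝ := fun ℓ j =>
    ∑ Γ ∈ (Finset.univ : Finset (StepSeq 2 ℓ)).filter
        (fun Γ => ∀ j' ≤ ℓ, j < j' → pos Γ j' ≠ pos Γ j), escProb n (pos Γ j) (verts Γ) with hBf
  have hBf0 : ∀ ℓ j, 0 ≤ Bf ℓ j := fun ℓ j => Finset.sum_nonneg fun Γ _ => escProb_nonneg _ _ _
  -- Step 1: the bridge
  have h1 : ∀ t₂ t₃ : ℕ, (1 - lam) ^ 2 * lam ^ (t₂ + t₃) / 4 ^ (t₂ + t₃) *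
      ∑ α : StepSeq 2 t₂, ∑ β ∈ noRet t₃, escProb n 0 (verts α ∪ verts β) =
        w (t₂ + t₃) * Bf (t₂ + t₃) t₂ := by
    intro t₂ t₃
    rw [sum_sum_noRet_escProb_eq n t₂ t₃]
  rw [Finset.sum_congr rfl fun t₂ _ => Finset.sum_congr rfl fun t₃ _ => h1 t₂ t₃]
  -- Step 2: regroup
  have h2 := sum_sum_le_sum_sigma (f := fun ℓ j => w ℓ * Bf ℓ j)
    (fun a b => mul_nonneg (hw0 a) (hBf0 a b)) n
  refine h2.trans ?_
  -- Step 3: last visits, per `ℓ`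
  have h3 : ∀ ℓ : ℕ, ∑ j ∈ Finset.range (ℓ + 1), Bf ℓ j =
      ∑ Γ : StepSeq 2 ℓ, ∑ x ∈ verts Γ, escProb n x (verts Γ) := by
    intro ℓ
    have hswap : ∑ j ∈ Finset.range (ℓ + 1), Bf ℓ j =
        ∑ Γ : StepSeq 2 ℓ, ∑ j ∈ (Finset.range (ℓ + 1)).filter
          (fun j => ∀ j' ≤ ℓ, j < j' → pos Γ j' ≠ pos Γ j), escProb n (pos Γ j) (verts Γ) := by
      rw [hBf]
      dsimp only
      simp_rw [Finset.sum_filter]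
      rw [Finset.sum_comm]
    rw [hswap]
    exact Finset.sum_congr rfl fun Γ _ => sum_filter_lastVisit_eq_sum_verts Γ fun x => escProb n x (verts Γ)
  -- Step 4: assemble
  calc ∑ ℓ ∈ Finset.range (2 * n + 1), ∑ j ∈ Finset.range (ℓ + 1), w ℓ * Bf ℓ j
      = ∑ ℓ ∈ Finset.range (2 * n + 1), w ℓ * ∑ Γ : StepSeq 2 ℓ, ∑ x ∈ verts Γ, escProb n x (verts Γ) := by
        refine Finset.sum_congr rfl fun ℓ _ => ?_
        rw [← Finset.mul_sum, h3 ℓ]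
    _ ≤ ∑ ℓ ∈ Finset.range (2 * n + 1), w ℓ * (100 * (cB⁻¹ * Real.exp 2400) * 4 ^ ℓ / (1 - lam ^ (n + 1))) := by
        refine Finset.sum_le_sum fun ℓ hℓ => mul_le_mul_of_nonneg_left ?_ (hw0 ℓ)
        exact sum_sum_escProb_verts_le hn hlam (Nat.le_of_lt_succ (Finset.mem_range.1 hℓ))
    _ = 100 * (cB⁻¹ * Real.exp 2400) * (1 - lam) ^ 2 / (1 - lam ^ (n + 1)) *
          ∑ ℓ ∈ Finset.range (2 * n + 1), lam ^ ℓ := by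
        rw [Finset.mul_sum]
        refine Finset.sum_congr rfl fun ℓ _ => ?_
        rw [hw]
        dsimp only
        field_simp
    _ ≤ 100 * (cB⁻¹ * Real.exp 2400) * (1 - lam) ^ 2 / (1 - lam ^ (n + 1)) * (1 / (1 - lam)) :=
        mul_le_mul_of_nonneg_left (geom_le hl0 hl1 _) (by positivity)
    _ = 100 * (cB⁻¹ * Real.exp 2400) * (1 - lam) / (1 - lam ^ (n + 1)) := by
        have : (1 - lam) ≠ 0 := by linarith
        field_simp

/-! ### `Φ ≤ 16 Φ⁺` -/

/-- **Multiplicity** (Lawler's Prop. 3.6.3 applied for each left half):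
`Φ ≤ 16 Φ⁺`. [cite: Lawler1991, Prop. 3.6.3] -/
theorem phi_le_sixteen_mul_phiPlus {n : ℕ} (hn : 2 ≤ n) {lam : ℝ} (hlam : lam = 1 - 1 / (n : ℝ)) :
    ∑ t₂ ∈ Finset.range (n + 1), ∑ t₃ ∈ Finset.range (n + 1),
        (1 - lam) ^ 2 * lam ^ (t₂ + t₃) / 4 ^ (t₂ + t₃) *
          ∑ α : StepSeq 2 t₂, ∑ β : StepSeq 2 t₃, escProb n 0 (verts α ∪ verts β) ≤
      16 * ∑ t₂ ∈ Finset.range (n + 1), ∑ t₃ ∈ Finset.range (n + 1),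
        (1 - lam) ^ 2 * lam ^ (t₂ + t₃) / 4 ^ (t₂ + t₃) *
          ∑ α : StepSeq 2 t₂, ∑ β ∈ noRet t₃, escProb n 0 (verts α ∪ verts β) := by
  have hn' : (0 : ℝ) < n := by positivity
  have hn1 : 1 ≤ n := by omega
  have hl0 : 0 ≤ lam := by
    rw [hlam, sub_nonneg, div_le_one hn']
    have : (2 : ℝ) ≤ n := by exact_mod_cast hn
    linarith
  have hl1 : lam ≤ 1 := by
    rw [hlam]
    have : (0 : ℝ) ≤ 1 / n := by positivity
    linarith
  set c : ℕ → ℝ := fun t => (1 - lam) * lam ^ t / 4 ^ t with hc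
  have hc0 : ∀ t, 0 ≤ c t := fun t => by rw [hc]; exact div_nonneg (mul_nonneg (by linarith) (pow_nonneg hl0 t)) (by positivity)
  have hsplit : ∀ t₂ t₃ : ℕ, (1 - lam) ^ 2 * lam ^ (t₂ + t₃) / 4 ^ (t₂ + t₃) = c t₂ * c t₃ := by
    intro t₂ t₃
    rw [hc]
    dsimp only
    rw [pow_add, pow_add]
    field_simp
  -- both sides as `Σ_{t₂} c t₂ Σ_α [Σ_{t₃} c t₃ Σ_β …]`
  have hL : ∀ G : (t₂ : ℕ) → ℕ → StepSeq 2 t₂ → ℝ,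
      ∑ t₂ ∈ Finset.range (n + 1), ∑ t₃ ∈ Finset.range (n + 1),
        (1 - lam) ^ 2 * lam ^ (t₂ + t₃) / 4 ^ (t₂ + t₃) * ∑ α : StepSeq 2 t₂, G t₂ t₃ α =
      ∑ t₂ ∈ Finset.range (n + 1), c t₂ * ∑ α : StepSeq 2 t₂, ∑ t₃ ∈ Finset.range (n + 1),
        c t₃ * G t₂ t₃ α := by
    intro G
    refine Finset.sum_congr rfl fun t₂ _ => ?_
    have e1 : ∀ t₃, (1 - lam) ^ 2 * lam ^ (t₂ + t₃) / 4 ^ (t₂ + t₃) * ∑ α : StepSeq 2 t₂, G t₂ t₃ α =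
        ∑ α : StepSeq 2 t₂, c t₂ * (c t₃ * G t₂ t₃ α) := by
      intro t₃
      rw [hsplit, Finset.mul_sum]
      refine Finset.sum_congr rfl fun α _ => ?_
      ring
    rw [Finset.sum_congr rfl fun t₃ _ => e1 t₃, Finset.sum_comm, Finset.mul_sum]
    refine Finset.sum_congr rfl fun α _ => ?_
    rw [Finset.mul_sum]
  have hL1 := hL (fun t₂ t₃ α => ∑ β : StepSeq 2 t₃, escProb n 0 (verts α ∪ verts β))
  have hL2 := hL (fun t₂ t₃ α => ∑ β ∈ noRet t₃, escProb n 0 (verts α ∪ verts β))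
  rw [hL1, hL2, Finset.mul_sum]
  refine Finset.sum_le_sum fun t₂ _ => ?_
  have hA : ∑ α : StepSeq 2 t₂, ∑ t₃ ∈ Finset.range (n + 1),
      c t₃ * ∑ β : StepSeq 2 t₃, escProb n 0 (verts α ∪ verts β) ≤
      16 * ∑ α : StepSeq 2 t₂, ∑ t₃ ∈ Finset.range (n + 1),
        c t₃ * ∑ β ∈ noRet t₃, escProb n 0 (verts α ∪ verts β) := by
    rw [Finset.mul_sum]
    refine Finset.sum_le_sum fun α _ => ?_
    have h := sum_escProb_le_sixteen_mul hn1 hl0 hl1 n (verts α)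
    simp only [hc]
    exact h
  calc c t₂ * ∑ α : StepSeq 2 t₂, ∑ t₃ ∈ Finset.range (n + 1),
        c t₃ * ∑ β : StepSeq 2 t₃, escProb n 0 (verts α ∪ verts β)
      ≤ c t₂ * (16 * ∑ α : StepSeq 2 t₂, ∑ t₃ ∈ Finset.range (n + 1),
          c t₃ * ∑ β ∈ noRet t₃, escProb n 0 (verts α ∪ verts β)) := mul_le_mul_of_nonneg_left hA (hc0 t₂)
    _ = 16 * (c t₂ * ∑ α : StepSeq 2 t₂, ∑ t₃ ∈ Finset.range (n + 1),
          c t₃ * ∑ β ∈ noRet t₃, escProb n 0 (verts α ∪ verts β)) := by ring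

/-! ### Truncation: `(1 - λ^{n+1})² F(n) ≤ Φ` -/

/-- The vertex set of a prefix is contained in the vertex set. [folklore] -/
theorem verts_pfxS_subset {m : ℕ} (α : StepSeq 2 m) {t : ℕ} (ht : t ≤ m) : verts (pfxS α t ht) ⊆ verts α := by
  intro x hx
  rw [mem_verts] at hx ⊢
  obtain ⟨j, hj, rfl⟩ := hx
  exact ⟨j, hj.trans ht, (pos_pfxS α ht hj).symm⟩

/-- Summing a function of the prefix: `Σ_{α ∈ StepSeq 2 m} g(α|ₜ) = 4^{m-t} Σ_{α' ∈ StepSeq 2 t} g(α')`.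
[folklore] -/
theorem sum_comp_pfxS {m t : ℕ} (ht : t ≤ m) (g : StepSeq 2 t → ℝ) :
    ∑ α : StepSeq 2 m, g (pfxS α t ht) = 4 ^ (m - t) * ∑ α' : StepSeq 2 t, g α' := by
  rw [Fintype.sum_equiv (splitEquivS ht) (fun α => g (pfxS α t ht)) (fun p => g p.1) (fun α => rfl),
    Fintype.sum_prod_type, Finset.mul_sum]
  refine Finset.sum_congr rfl fun α' _ => ?_
  dsimp only
  rw [Finset.sum_const, Finset.card_univ, card_stepSeq, nsmul_eq_mul]
  norm_num

/-- **Truncation**: prefixes are avoided more easily, so for `t₂, t₃ ≤ m`,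
`16^{-m} Σ_{α,β ∈ StepSeq 2 m} q_n(0; verts α ∪ verts β) ≤ 4^{-(t₂+t₃)} Σ_{α' ∈ StepSeq 2 t₂, β'} q_n(0; verts α' ∪ verts β')`.
[cite: Lawler1991, Lemma 3.2.4] -/
theorem trunc (n m : ℕ) {t₂ t₃ : ℕ} (h₂ : t₂ ≤ m) (h₃ : t₃ ≤ m) :
    (∑ α : StepSeq 2 m, ∑ β : StepSeq 2 m, escProb n 0 (verts α ∪ verts β)) / 16 ^ m ≤
      (∑ α : StepSeq 2 t₂, ∑ β : StepSeq 2 t₃, escProb n 0 (verts α ∪ verts β)) / 4 ^ (t₂ + t₃) := by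
  have hmono : ∑ α : StepSeq 2 m, ∑ β : StepSeq 2 m, escProb n 0 (verts α ∪ verts β) ≤
      ∑ α : StepSeq 2 m, ∑ β : StepSeq 2 m,
        escProb n 0 (verts (pfxS α t₂ h₂) ∪ verts (pfxS β t₃ h₃)) :=
    Finset.sum_le_sum fun α _ => Finset.sum_le_sum fun β _ =>
      escProb_anti (Finset.union_subset_union (verts_pfxS_subset α h₂) (verts_pfxS_subset β h₃))
  have heq : ∑ α : StepSeq 2 m, ∑ β : StepSeq 2 m,
      escProb n 0 (verts (pfxS α t₂ h₂) ∪ verts (pfxS β t₃ h₃)) =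
        4 ^ (m - t₂) * 4 ^ (m - t₃) * ∑ α : StepSeq 2 t₂, ∑ β : StepSeq 2 t₃, escProb n 0 (verts α ∪ verts β) := by
    have hA : ∀ α : StepSeq 2 m, ∑ β : StepSeq 2 m, escProb n 0 (verts (pfxS α t₂ h₂) ∪ verts (pfxS β t₃ h₃)) =
        4 ^ (m - t₃) * ∑ β' : StepSeq 2 t₃, escProb n 0 (verts (pfxS α t₂ h₂) ∪ verts β') :=
      fun α => sum_comp_pfxS h₃ (fun β' => escProb n 0 (verts (pfxS α t₂ h₂) ∪ verts β'))
    have hB : ∑ α : StepSeq 2 m, ∑ β' : StepSeq 2 t₃, escProb n 0 (verts (pfxS α t₂ h₂) ∪ verts β') =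
        4 ^ (m - t₂) * ∑ α' : StepSeq 2 t₂, ∑ β' : StepSeq 2 t₃, escProb n 0 (verts α' ∪ verts β') :=
      sum_comp_pfxS h₂ (fun α' => ∑ β' : StepSeq 2 t₃, escProb n 0 (verts α' ∪ verts β'))
    rw [Finset.sum_congr rfl fun α _ => hA α, ← Finset.mul_sum, hB]
    ring
  rw [div_le_div_iff₀ (by positivity) (by positivity)]
  have e2 : (4 : ℝ) ^ (m - t₂) * 4 ^ t₂ = 4 ^ m := by rw [← pow_add, Nat.sub_add_cancel h₂]
  have e3 : (4 : ℝ) ^ (m - t₃) * 4 ^ t₃ = 4 ^ m := by rw [← pow_add, Nat.sub_add_cancel h₃]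
  have h16 : (16 : ℝ) ^ m = 4 ^ (m - t₂) * 4 ^ (m - t₃) * 4 ^ (t₂ + t₃) := by
    rw [pow_add]
    calc (16 : ℝ) ^ m = 4 ^ m * 4 ^ m := by rw [← mul_pow]; norm_num
      _ = (4 ^ (m - t₂) * 4 ^ t₂) * (4 ^ (m - t₃) * 4 ^ t₃) := by rw [e2, e3]
      _ = _ := by ring
  calc (∑ α : StepSeq 2 m, ∑ β : StepSeq 2 m, escProb n 0 (verts α ∪ verts β)) * 4 ^ (t₂ + t₃)
      ≤ (4 ^ (m - t₂) * 4 ^ (m - t₃) *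
          ∑ α : StepSeq 2 t₂, ∑ β : StepSeq 2 t₃, escProb n 0 (verts α ∪ verts β)) * 4 ^ (t₂ + t₃) := by
        rw [← heq]
        exact mul_le_mul_of_nonneg_right hmono (by positivity)
    _ = (∑ α : StepSeq 2 t₂, ∑ β : StepSeq 2 t₃, escProb n 0 (verts α ∪ verts β)) * 16 ^ m := by
        rw [h16]
        ring

/-- **`F(n) ≤ C / n`** with `C = 12800 · 16 · 100 · cB⁻¹ e^{2400}`: truncation, multiplicity, the
bound on `Φ⁺`, and `1 - λ^{n+1} ≥ 1/2`. [cite: Lawler1991, Thm. 3.5.1 (d = 2, upper half)] -/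
theorem F_le {n : ℕ} (hn : 2 ≤ n) :
    (∑ α : StepSeq 2 n, ∑ β : StepSeq 2 n, escProb n 0 (verts α ∪ verts β)) / 16 ^ n ≤
      12800 * (100 * (cB⁻¹ * Real.exp 2400)) / n := by
  obtain ⟨lam, hlam⟩ : ∃ lam : ℝ, lam = 1 - 1 / (n : ℝ) := ⟨_, rfl⟩
  have hn' : (0 : ℝ) < n := by positivity
  have hn2 : (2 : ℝ) ≤ n := by exact_mod_cast hn
  have hl0 : 0 ≤ lam := by
    rw [hlam, sub_nonneg, div_le_one hn']
    linarith
  have hl1 : lam < 1 := by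
    rw [hlam]
    have : (0 : ℝ) < 1 / n := by positivity
    linarith
  set F : ℝ := (∑ α : StepSeq 2 n, ∑ β : StepSeq 2 n, escProb n 0 (verts α ∪ verts β)) / 16 ^ n with hF
  have hF0 : 0 ≤ F := by
    rw [hF]
    exact div_nonneg (Finset.sum_nonneg fun α _ => Finset.sum_nonneg fun β _ => escProb_nonneg _ _ _)
      (by positivity)
  set K : ℝ := 100 * (cB⁻¹ * Real.exp 2400) with hK
  have hK0 : 0 ≤ K := by rw [hK]; exact mul_nonneg (by norm_num) (mul_nonneg (inv_nonneg.2 cB_pos.le) (Real.exp_pos _).le)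
  -- `1 - λ^{n+1} ≥ 1/2`
  have hhalf : 1 / 2 ≤ 1 - lam ^ (n + 1) := by
    have h1 : lam ^ n ≤ Real.exp (-1) := by
      rw [hlam]
      have := Real.one_sub_div_pow_le_exp_neg (n := n) (t := 1) (by
        have : (1 : ℝ) ≤ n := by linarith
        exact this)
      simpa using this
    have h2 : Real.exp (-1) ≤ 1 / 2 := by
      rw [Real.exp_neg, inv_eq_one_div, div_le_div_iff₀ (Real.exp_pos _) (by norm_num)]
      linarith [Real.add_one_le_exp (1 : ℝ)]
    have h3 : lam ^ (n + 1) ≤ lam ^ n := pow_le_pow_of_le_one hl0 hl1.le (Nat.le_succ n)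
    linarith
  -- truncation summed with the weights
  have hgeom : ∑ t ∈ Finset.range (n + 1), (1 - lam) * lam ^ t = 1 - lam ^ (n + 1) := by
    rw [← Finset.mul_sum, mul_comm, geom_sum_mul_neg]
  have htrunc : (1 - lam ^ (n + 1)) ^ 2 * F ≤
      ∑ t₂ ∈ Finset.range (n + 1), ∑ t₃ ∈ Finset.range (n + 1),
        (1 - lam) ^ 2 * lam ^ (t₂ + t₃) / 4 ^ (t₂ + t₃) *
          ∑ α : StepSeq 2 t₂, ∑ β : StepSeq 2 t₃, escProb n 0 (verts α ∪ verts β) := by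
    calc (1 - lam ^ (n + 1)) ^ 2 * F
        = ∑ t₂ ∈ Finset.range (n + 1), ∑ t₃ ∈ Finset.range (n + 1),
            (1 - lam) ^ 2 * lam ^ (t₂ + t₃) * F := by
          rw [← hgeom, sq, Finset.sum_mul_sum, Finset.sum_mul]
          refine Finset.sum_congr rfl fun t₂ _ => ?_
          rw [Finset.sum_mul]
          refine Finset.sum_congr rfl fun t₃ _ => ?_
          rw [pow_add]
          ring
      _ ≤ _ := by
          refine Finset.sum_le_sum fun t₂ h₂ => Finset.sum_le_sum fun t₃ h₃ => ?_
          have ht₂ : t₂ ≤ n := Nat.le_of_lt_succ (Finset.mem_range.1 h₂)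
          have ht₃ : t₃ ≤ n := Nat.le_of_lt_succ (Finset.mem_range.1 h₃)
          have h := trunc n n ht₂ ht₃
          rw [← hF] at h
          have hw : 0 ≤ (1 - lam) ^ 2 * lam ^ (t₂ + t₃) := by positivity
          calc (1 - lam) ^ 2 * lam ^ (t₂ + t₃) * F ≤
              (1 - lam) ^ 2 * lam ^ (t₂ + t₃) *
                ((∑ α : StepSeq 2 t₂, ∑ β : StepSeq 2 t₃, escProb n 0 (verts α ∪ verts β)) / 4 ^ (t₂ + t₃)) :=
                mul_le_mul_of_nonneg_left h hw
            _ = _ := by ring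
  have hphi := phi_le_sixteen_mul_phiPlus hn hlam
  have hplus := phiPlus_le hn hlam
  have hc : 0 < 1 - lam ^ (n + 1) := by linarith
  -- `(1-λ^{n+1})² F ≤ 16 · 100K (1-λ)/(1-λ^{n+1})`
  have hmain : (1 - lam ^ (n + 1)) ^ 2 * F ≤ 16 * (K * (1 - lam) / (1 - lam ^ (n + 1))) := by
    rw [hK]
    exact htrunc.trans (hphi.trans (mul_le_mul_of_nonneg_left hplus (by norm_num)))
  -- solve for `F`
  have hlam1 : 1 - lam = 1 / n := by rw [hlam]; ring
  rw [hlam1] at hmain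
  have h3 : (1 - lam ^ (n + 1)) ^ 3 * F ≤ 16 * K / n := by
    have := mul_le_mul_of_nonneg_left hmain hc.le
    calc (1 - lam ^ (n + 1)) ^ 3 * F = (1 - lam ^ (n + 1)) * ((1 - lam ^ (n + 1)) ^ 2 * F) := by ring
      _ ≤ (1 - lam ^ (n + 1)) * (16 * (K * (1 / n) / (1 - lam ^ (n + 1)))) := this
      _ = 16 * K / n := by field_simp
  have h8 : 1 / 8 ≤ (1 - lam ^ (n + 1)) ^ 3 := by nlinarith [hhalf]
  have hKn : 0 ≤ 16 * K / n := by positivity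
  calc F = F * 1 := (mul_one F).symm
    _ ≤ F * (8 * (1 - lam ^ (n + 1)) ^ 3) := mul_le_mul_of_nonneg_left (by linarith) hF0
    _ = 8 * ((1 - lam ^ (n + 1)) ^ 3 * F) := by ring
    _ ≤ 8 * (16 * K / n) := mul_le_mul_of_nonneg_left h3 (by norm_num)
    _ = 12800 * K / n / 100 := by ring
    _ ≤ 12800 * K / n := by
        apply div_le_self (by positivity) (by norm_num)

/-! ### The glue: Cauchy–Schwarz over the walk from the origin -/

/-- `e_{(0,-)} = -e₁`. [folklore] -/
theorem stepVec_zero_false : stepVec (((0 : Fin 2), false) : Dir 2) = -e₁ := by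
  rw [show (((0 : Fin 2), false) : Dir 2) = Dir.neg (((0 : Fin 2), true) : Dir 2) from rfl, stepVec_neg,
    stepVec_zero_true]

/-- **Glue** (Cauchy–Schwarz over the walk from `0`, first step of an escape): for `k ≥ 1`,
`(N(k)/16^k)² ≤ 4 F(k)` with `F(k) = 16^{-k} Σ_{α,β} q_k(0; verts α ∪ verts β)`. [folklore] -/
theorem sq_nonIntersectingPairs_div_le {k : ℕ} (hk : 1 ≤ k) :
    ((nonIntersectingPairs k : ℝ) / 16 ^ k) ^ 2 ≤
      4 * ((∑ α : StepSeq 2 k, ∑ β : StepSeq 2 k, escProb k 0 (verts α ∪ verts β)) / 16 ^ k) := by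
  classical
  obtain ⟨k', rfl⟩ : ∃ k', k = k' + 1 := ⟨k - 1, by omega⟩
  set NI : StepSeq 2 (k' + 1) → StepSeq 2 (k' + 1) → Prop :=
    fun ω α => ∀ i ≤ k' + 1, ∀ j ≤ k' + 1, pos ω i ≠ e₁ + pos α j with hNI
  set Y : StepSeq 2 (k' + 1) → ℝ := fun ω => #{α : StepSeq 2 (k' + 1) | NI ω α} with hY
  -- `N = Σ_ω Y ω`
  have hN : (nonIntersectingPairs (k' + 1) : ℝ) = ∑ ω : StepSeq 2 (k' + 1), Y ω := by
    rw [nonIntersectingPairs_eq_card_filter_stepSeq, Finset.card_filter, Nat.cast_sum,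
      Fintype.sum_prod_type]
    refine Finset.sum_congr rfl fun ω _ => ?_
    rw [hY]
    dsimp only
    rw [Finset.card_filter, Nat.cast_sum]
  -- Cauchy–Schwarz
  have hCS : (∑ ω : StepSeq 2 (k' + 1), Y ω) ^ 2 ≤ (4 : ℝ) ^ (k' + 1) * ∑ ω : StepSeq 2 (k' + 1), Y ω ^ 2 := by
    have h := sq_sum_le_card_mul_sum_sq (s := (Finset.univ : Finset (StepSeq 2 (k' + 1)))) (f := Y)
    rw [Finset.card_univ, card_stepSeq] at h
    have h4 : (((2 * 2) ^ (k' + 1) : ℕ) : ℝ) = 4 ^ (k' + 1) := by norm_num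
    rw [h4] at h
    exact h
  -- `Y ω ² = #{(α, β) : NI ω α ∧ NI ω β}`
  have hsq : ∀ ω, Y ω ^ 2 = #{p : StepSeq 2 (k' + 1) × StepSeq 2 (k' + 1) | NI ω p.1 ∧ NI ω p.2} := by
    intro ω
    rw [hY]
    dsimp only
    rw [sq, ← Nat.cast_mul, ← Finset.card_product]
    congr 2
    rw [← Finset.filter_product, Finset.univ_product_univ]
  -- swap the counting
  have hswap : ∑ ω : StepSeq 2 (k' + 1),
      (#{p : StepSeq 2 (k' + 1) × StepSeq 2 (k' + 1) | NI ω p.1 ∧ NI ω p.2} : ℝ) =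
      ∑ p : StepSeq 2 (k' + 1) × StepSeq 2 (k' + 1),
        (#{ω : StepSeq 2 (k' + 1) | NI ω p.1 ∧ NI ω p.2} : ℝ) := by
    simp only [Finset.card_filter, Nat.cast_sum]
    rw [Finset.sum_comm]
  -- the fibre bound
  have hv0 : stepVec (((0 : Fin 2), false) : Dir 2) = -e₁ := stepVec_zero_false
  have hfib : ∀ p : StepSeq 2 (k' + 1) × StepSeq 2 (k' + 1),
      (#{ω : StepSeq 2 (k' + 1) | NI ω p.1 ∧ NI ω p.2} : ℝ) ≤
        4 * #(escSet (k' + 1) 0 (verts p.1 ∪ verts p.2)) := by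
    rintro ⟨α, β⟩
    dsimp only
    by_cases hA : -e₁ ∈ verts α ∪ verts β
    · -- nothing avoids: at time `0` the walk is at `0 = e₁ + (-e₁)`
      have hempty : ({ω : StepSeq 2 (k' + 1) | NI ω α ∧ NI ω β} : Finset (StepSeq 2 (k' + 1))) = ∅ := by
        rw [Finset.eq_empty_iff_forall_notMem]
        intro ω hω
        rw [Finset.mem_filter] at hω
        obtain ⟨-, h1, h2⟩ := hω
        rw [Finset.mem_union, mem_verts, mem_verts] at hA
        rcases hA with ⟨j, hj, hja⟩ | ⟨j, hj, hja⟩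
        · exact h1 0 (Nat.zero_le _) j hj (by rw [pos_zero, hja]; simp)
        · exact h2 0 (Nat.zero_le _) j hj (by rw [pos_zero, hja]; simp)
      rw [hempty, Finset.card_empty, Nat.cast_zero]
      positivity
    · have hsub : ({ω : StepSeq 2 (k' + 1) | NI ω α ∧ NI ω β} : Finset (StepSeq 2 (k' + 1))) ⊆
          escSet (k' + 1) (-e₁) (verts α ∪ verts β) := by
        intro ω hω
        rw [Finset.mem_filter] at hω
        obtain ⟨-, h1, h2⟩ := hω
        rw [mem_escSet]
        intro i hi hmem
        rw [Finset.mem_union, mem_verts, mem_verts] at hmem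
        rcases hmem with ⟨j, hj, hja⟩ | ⟨j, hj, hja⟩
        · exact h1 (i + 1) (by omega) j hj (by rw [hja]; abel)
        · exact h2 (i + 1) (by omega) j hj (by rw [hja]; abel)
      have h3 := card_escSet_stepVec_le k' (((0 : Fin 2), false) : Dir 2) (verts α ∪ verts β)
        (by rw [hv0]; exact hA)
      rw [hv0] at h3
      calc (#({ω : StepSeq 2 (k' + 1) | NI ω α ∧ NI ω β} : Finset (StepSeq 2 (k' + 1))) : ℝ)
          ≤ #(escSet (k' + 1) (-e₁) (verts α ∪ verts β)) := by exact_mod_cast Finset.card_le_card hsub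
        _ ≤ 4 * #(escSet (k' + 1) 0 (verts α ∪ verts β)) := by exact_mod_cast h3
  -- `Σ_p #escSet = 4^k · 16^k · F`
  have hesc : ∀ p : StepSeq 2 (k' + 1) × StepSeq 2 (k' + 1),
      (#(escSet (k' + 1) 0 (verts p.1 ∪ verts p.2)) : ℝ) =
        4 ^ (k' + 1) * escProb (k' + 1) 0 (verts p.1 ∪ verts p.2) := by
    intro p
    rw [escProb, mul_div_cancel₀ _ (by positivity)]
  -- assemble
  have h16 : (0 : ℝ) < 16 ^ (k' + 1) := by positivity
  have hmain : (nonIntersectingPairs (k' + 1) : ℝ) ^ 2 ≤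
      4 * 16 ^ (k' + 1) * ∑ α : StepSeq 2 (k' + 1), ∑ β : StepSeq 2 (k' + 1),
        escProb (k' + 1) 0 (verts α ∪ verts β) := by
    calc (nonIntersectingPairs (k' + 1) : ℝ) ^ 2 = (∑ ω : StepSeq 2 (k' + 1), Y ω) ^ 2 := by rw [hN]
      _ ≤ (4 : ℝ) ^ (k' + 1) * ∑ ω : StepSeq 2 (k' + 1), Y ω ^ 2 := hCS
      _ = (4 : ℝ) ^ (k' + 1) * ∑ p : StepSeq 2 (k' + 1) × StepSeq 2 (k' + 1),
            (#{ω : StepSeq 2 (k' + 1) | NI ω p.1 ∧ NI ω p.2} : ℝ) := by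
          rw [Finset.sum_congr rfl fun ω _ => hsq ω, hswap]
      _ ≤ (4 : ℝ) ^ (k' + 1) * ∑ p : StepSeq 2 (k' + 1) × StepSeq 2 (k' + 1),
            4 * (4 ^ (k' + 1) * escProb (k' + 1) 0 (verts p.1 ∪ verts p.2)) := by
          refine mul_le_mul_of_nonneg_left (Finset.sum_le_sum fun p _ => ?_) (by positivity)
          rw [← hesc p]
          exact hfib p
      _ = 4 * 16 ^ (k' + 1) * ∑ α : StepSeq 2 (k' + 1), ∑ β : StepSeq 2 (k' + 1),
            escProb (k' + 1) 0 (verts α ∪ verts β) := by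
          rw [Fintype.sum_prod_type]
          have h44 : (16 : ℝ) ^ (k' + 1) = 4 ^ (k' + 1) * 4 ^ (k' + 1) := by rw [← mul_pow]; norm_num
          simp only [Finset.mul_sum]
          refine Finset.sum_congr rfl fun α _ => Finset.sum_congr rfl fun β _ => ?_
          rw [h44]
          ring
  rw [div_pow, div_le_iff₀ (by positivity)]
  calc (nonIntersectingPairs (k' + 1) : ℝ) ^ 2 ≤ _ := hmain
    _ = 4 * ((∑ α : StepSeq 2 (k' + 1), ∑ β : StepSeq 2 (k' + 1),
          escProb (k' + 1) 0 (verts α ∪ verts β)) / 16 ^ (k' + 1)) * (16 ^ (k' + 1)) ^ 2 := by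
        field_simp

/-! ### The upper bound `N(k)/16^k ≤ C k^{-1/2}` -/

/-- **`N(k)/16^k ≤ C · k^{-1/2}`** (Lawler's (3.29), upper half, `d = 2`, for two walks from
neighbouring points with closed ranges; `C` absurd but explicit): the probability that two
independent `k`-step planar simple random walks from neighbouring vertices do not intersect is
`O(k^{-1/2})`. This is NOT the vendored fact `LSW2001_srw_nonIntersection_five_eighths`
(exponent `5/8`). [cite: Lawler1991, (3.29)] -/
theorem nonIntersectingPairs_div_le_rpow :
    ∃ C : ℝ, 0 < C ∧ ∀ k : ℕ, 1 ≤ k →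
      (nonIntersectingPairs k : ℝ) / 16 ^ k ≤ C * (k : ℝ) ^ (-(1 / 2 : ℝ)) := by
  set Kf : ℝ := 12800 * (100 * (cB⁻¹ * Real.exp 2400)) with hKf
  have hKf0 : 0 ≤ Kf := by
    rw [hKf]
    exact mul_nonneg (by norm_num) (mul_nonneg (by norm_num)
      (mul_nonneg (inv_nonneg.2 cB_pos.le) (Real.exp_pos _).le))
  refine ⟨Real.sqrt (4 * Kf) + 1, by positivity, fun k hk => ?_⟩
  have hk' : (0 : ℝ) < k := by exact_mod_cast hk
  have hP0 : 0 ≤ (nonIntersectingPairs k : ℝ) / 16 ^ k := by positivity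
  have hrpow : (k : ℝ) ^ (-(1 / 2 : ℝ)) = 1 / Real.sqrt k := by
    rw [Real.rpow_neg hk'.le, Real.sqrt_eq_rpow, inv_eq_one_div]
  rcases Nat.lt_or_ge k 2 with hk1 | hk2
  · -- `k = 1`
    have hk1' : k = 1 := by omega
    subst hk1'
    have h1 := nonIntersectingPairs_div_le_one 1
    rw [Nat.cast_one, Real.one_rpow, mul_one]
    have : (0 : ℝ) ≤ Real.sqrt (4 * Kf) := Real.sqrt_nonneg _
    linarith
  · have hF := F_le hk2
    have hsq := sq_nonIntersectingPairs_div_le (k := k) (by omega)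
    have hbound : ((nonIntersectingPairs k : ℝ) / 16 ^ k) ^ 2 ≤ 4 * Kf / k := by
      rw [hKf]
      calc ((nonIntersectingPairs k : ℝ) / 16 ^ k) ^ 2 ≤ _ := hsq
        _ ≤ 4 * (12800 * (100 * (cB⁻¹ * Real.exp 2400)) / k) :=
            mul_le_mul_of_nonneg_left hF (by norm_num)
        _ = _ := by ring
    have hle : (nonIntersectingPairs k : ℝ) / 16 ^ k ≤ Real.sqrt (4 * Kf / k) := by
      rw [← Real.sqrt_sq hP0]
      exact Real.sqrt_le_sqrt hbound
    rw [hrpow]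
    calc (nonIntersectingPairs k : ℝ) / 16 ^ k ≤ Real.sqrt (4 * Kf / k) := hle
      _ = Real.sqrt (4 * Kf) * (1 / Real.sqrt k) := by
          rw [Real.sqrt_div (by positivity), one_div, div_eq_mul_inv]
      _ ≤ (Real.sqrt (4 * Kf) + 1) * (1 / Real.sqrt k) :=
          mul_le_mul_of_nonneg_right (by linarith) (by positivity)

end PlaneNonIntersection

end Literature.Probability.RandomPlanarGeometry

end
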